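import Summits.CriticalPhenomena.PercolationContinuityZ3.Theorems.PercNearOneGluingNoHeavyLowerTailSahiSwitchFactoredBridge
import Summits.CriticalPhenomena.PercolationContinuityZ3.Theorems.PercNearOneGluingNoHeavyLowerTailSahiStrongCubicMax
import Mathlib.Data.Fintype.Sets
import HarnessLib

/-!
# `NoHeavyLowerTail` (crux stmt-CriticalPhenomena-4575), master-family line P1 (gen 24):
# TRANSPORT — the typed comb conjecture (SPLIT) implies the typed measure conjecture S₃^max (`StrongCubicMaxNonneg`)

Support file (seat `prim-masterthm-p1`, gen 24; `--supports stmt-CriticalPhenomena-4575`).  No `sorry`, standard axioms.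
Memo `run/shared/lean/prim/prim-masterthm/FROM-prim-masterthm-p1-g24-FACE-RULE.md`.

PROVED HERE: **`strongCubicMaxNonneg_of_switchFactoredSplit : SwitchFactoredSplit → StrongCubicMaxNonneg p`** for every finite
coordinate type `ι` and every bias vector `p : ι → unitInterval` — so, with the tree's kernel links (`…SahiStrongCubicMax`:
`strongCubicPlusNonneg_of_max`, `strongCubic_nonneg_of_max`, `classLaw_of_max`, `coSunflower_nonneg_of_max`), the single comb
statement (SPLIT) of `…SahiSwitchFactoredSplit` now formally implies S₃^max ⟹ S₃⁺ ⟹ S₃ ⟹ the co-sunflower class law at every product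
measure.  MECHANISM: a sandwiched triple `(A,B,N)` of up-sets on `Set ι` is coded along `Fintype.equivFin ι` as the `M₃`-labelling
`labOf` of the cube `Finset (Fin n)` (`codeEquiv`, `isM3Monotone_labOf` — the sandwich hypotheses `A∖B ⊆ N`, `B∖A ⊆ N` give the
monotonicity into the diamond), cell masses transport (`ex_ind_eq_mass`: `μ_p(X) = mass (p ∘ e⁻¹) {x | code x ∈ X}` by
`Fintype.sum_equiv` / `Fintype.prod_equiv`), and the cube-level bridge `strongCubicMax_of_splitCertificate` of `…SahiSwitchFactoredBridge`
gives `αβd ≤ max(κ,o)·(κo − e₂)`, i.e. `0 ≤ strongCubicMax p A B N`.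
HONEST FRAMING: an implication between two typed conjectures; (SPLIT) and S₃^max remain OPEN. [this work]
-/

noncomputable section

namespace Summit.CriticalPhenomena.PercolationContinuityZ3.Theorems


namespace SahiSwitchFactored

open Finset
open Literature.Combinatorics.Sahi2008
open Literature.Probability.Percolation.BHK2006 (weight)
open Literature.Probability.Percolation.DecisionTree (ind ind_of_mem ind_of_not_mem)

variable {ι : Type} [Fintype ι]

/-- Configurations of `ι` coded as point sets of `Fin n` along an enumeration `e`. [this work] -/
noncomputable def codeEquiv {n : ℕ} (e : ι ≃ Fin n) : Finset (Fin n) ≃ Set ι :=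
  (e.symm.finsetCongr).trans Fintype.finsetEquivSet

/-- Membership in a coded configuration. [this work] -/
theorem mem_codeEquiv {n : ℕ} (e : ι ≃ Fin n) (x : Finset (Fin n)) (j : ι) : j ∈ codeEquiv e x ↔ e j ∈ x := by
  unfold codeEquiv
  simp only [Equiv.trans_apply, Fintype.finsetEquivSet_apply, Equiv.finsetCongr_apply, Finset.coe_map,
    Equiv.coe_toEmbedding, Set.mem_image, Finset.mem_coe]
  constructor
  · rintro ⟨i, hi, rfl⟩; simpa using hi
  · intro h; exact ⟨e j, h, by simp⟩

/-- Coding is monotone. [this work] -/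
theorem codeEquiv_mono {n : ℕ} (e : ι ≃ Fin n) {x y : Finset (Fin n)} (h : x ⊆ y) : codeEquiv e x ≤ codeEquiv e y :=
  fun j hj => (mem_codeEquiv e y j).2 (h ((mem_codeEquiv e x j).1 hj))

open scoped Classical in
/-- The `M₃`-labelling of a sandwiched triple `(A,B,N)`: `4` on `A∩B∩N`, `1` on `A∖B`, `2` on `B∖A`, `3` on `(A∩B)∖N`, `0` outside. [this work] -/
noncomputable def labOf {n : ℕ} (e : ι ≃ Fin n) (A B N : Set (Set ι)) (x : Finset (Fin n)) : Fin 5 :=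
  if codeEquiv e x ∈ A then (if codeEquiv e x ∈ B then (if codeEquiv e x ∈ N then 4 else 3) else 1)
  else (if codeEquiv e x ∈ B then 2 else 0)

section cells
variable {n : ℕ} (e : ι ≃ Fin n) {A B N : Set (Set ι)}

/-- Cell `4` is the core `A∩B∩N`. [this work] -/
theorem labOf_eq_four_iff (x : Finset (Fin n)) : labOf e A B N x = 4 ↔ codeEquiv e x ∈ A ∩ B ∩ N := by
  unfold labOf; split_ifs <;> simp_all

/-- Cell `1` is the petal `A∖B`. [this work] -/
theorem labOf_eq_one_iff (x : Finset (Fin n)) : labOf e A B N x = 1 ↔ codeEquiv e x ∈ A \ B := by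
  unfold labOf; split_ifs <;> simp_all

/-- Cell `2` is the petal `B∖A`. [this work] -/
theorem labOf_eq_two_iff (x : Finset (Fin n)) : labOf e A B N x = 2 ↔ codeEquiv e x ∈ B \ A := by
  unfold labOf; split_ifs <;> simp_all

/-- Cell `3` is the petal `(A∩B)∖N`. [this work] -/
theorem labOf_eq_three_iff (x : Finset (Fin n)) : labOf e A B N x = 3 ↔ codeEquiv e x ∈ (A ∩ B) \ N := by
  unfold labOf; split_ifs <;> simp_all

/-- Cell `0` is the outside `(A∪B)ᶜ`. [this work] -/
theorem labOf_eq_zero_iff (x : Finset (Fin n)) : labOf e A B N x = 0 ↔ codeEquiv e x ∈ (A ∪ B)ᶜ := by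
  unfold labOf; split_ifs <;> simp_all

/-- The labelling of a sandwiched triple of up-sets is `M₃`-monotone. [this work] -/
theorem isM3Monotone_labOf (hA : IsUpperSet A) (hB : IsUpperSet B) (hN : IsUpperSet N) (hAB : A \ B ⊆ N) (hBA : B \ A ⊆ N) :
    IsM3Monotone (labOf e A B N) := by
  intro x y hxy
  have hle := codeEquiv_mono e hxy
  by_cases h4 : codeEquiv e y ∈ A ∩ B ∩ N
  · right; right; exact (labOf_eq_four_iff e y).2 h4
  by_cases hxA : codeEquiv e x ∈ A
  · by_cases hxB : codeEquiv e x ∈ B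
    · by_cases hxN : codeEquiv e x ∈ N
      · exact absurd ⟨⟨hA hle hxA, hB hle hxB⟩, hN hle hxN⟩ h4
      · left
        have hyN : codeEquiv e y ∉ N := fun h => h4 ⟨⟨hA hle hxA, hB hle hxB⟩, h⟩
        rw [(labOf_eq_three_iff e x).2 ⟨⟨hxA, hxB⟩, hxN⟩, eq_comm, labOf_eq_three_iff]
        exact ⟨⟨hA hle hxA, hB hle hxB⟩, hyN⟩
    · left
      have hyB : codeEquiv e y ∉ B := fun h => h4 ⟨⟨hA hle hxA, h⟩, hN hle (hAB ⟨hxA, hxB⟩)⟩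
      rw [(labOf_eq_one_iff e x).2 ⟨hxA, hxB⟩, eq_comm, labOf_eq_one_iff]
      exact ⟨hA hle hxA, hyB⟩
  · by_cases hxB : codeEquiv e x ∈ B
    · left
      have hyA : codeEquiv e y ∉ A := fun h => h4 ⟨⟨h, hB hle hxB⟩, hN hle (hBA ⟨hxB, hxA⟩)⟩
      rw [(labOf_eq_two_iff e x).2 ⟨hxB, hxA⟩, eq_comm, labOf_eq_two_iff]
      exact ⟨hB hle hxB, hyA⟩
    · right; left
      refine (labOf_eq_zero_iff e x).2 ?_
      rintro (h | h)
      exacts [hxA h, hxB h]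

end cells

open scoped Classical in
/-- Masses transport: `μ_p(X) = mass (p ∘ e⁻¹) {x | code x ∈ X}`. [this work] -/
theorem ex_ind_eq_mass {n : ℕ} (e : ι ≃ Fin n) (p : ι → unitInterval) (X : Set (Set ι)) :
    ex (bernoulliWeight p) (ind X) = mass (fun i => (p (e.symm i) : ℝ)) (univ.filter fun x => codeEquiv e x ∈ X) := by
  classical
  unfold mass
  rw [Finset.sum_filter, ex]
  rw [← Fintype.sum_equiv (codeEquiv e) (fun x => if codeEquiv e x ∈ X then wt (fun i => (p (e.symm i) : ℝ)) x else 0)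
    (fun ω => bernoulliWeight p ω * ind X ω)]
  intro x
  have hw : bernoulliWeight p (codeEquiv e x) = wt (fun i => (p (e.symm i) : ℝ)) x := by
    unfold wt
    show weight (fun j => (p j : ℝ)) (codeEquiv e x) = _
    unfold weight
    rw [← Fintype.prod_equiv e.symm (fun i => if i ∈ x then (p (e.symm i) : ℝ) else 1 - p (e.symm i))
      (fun j => if j ∈ codeEquiv e x then (p j : ℝ) else 1 - p j)]
    intro i
    simp only [mem_codeEquiv, Equiv.apply_symm_apply]
  by_cases hx : codeEquiv e x ∈ X
  · rw [if_pos hx, ind_of_mem hx, mul_one, hw]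
  · rw [if_neg hx, ind_of_not_mem hx, mul_zero]

open scoped Classical in
/-- **(SPLIT) ⟹ S₃^max** in the tree's `Set ι` form: the typed comb conjecture `SwitchFactoredSplit` implies
`SahiDeepCore.StrongCubicMaxNonneg p` for every finite coordinate type and every bias vector. [this work] -/
theorem strongCubicMaxNonneg_of_switchFactoredSplit (h : SwitchFactoredSplit) (p : ι → unitInterval) :
    SahiDeepCore.StrongCubicMaxNonneg p := by
  classical
  intro S A B N hA hB hN hAB hBA hNAB _ _ _
  set n := Fintype.card ι
  set e : ι ≃ Fin n := Fintype.equivFin ι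
  set lab := labOf e A B N with hlab
  obtain ⟨P, Q, hPQ⟩ := h n lab (isM3Monotone_labOf e hA hB hN hAB hBA)
  set p' : Fin n → ℝ := fun i => (p (e.symm i) : ℝ) with hp'
  have hp : ∀ i, 0 ≤ p' i ∧ p' i ≤ 1 := fun i => ⟨(p (e.symm i)).2.1, (p (e.symm i)).2.2⟩
  have key := strongCubicMax_of_splitCertificate p' lab hPQ hp
  -- identify the five cells
  have hc : ∀ (c : Fin 5) (X : Set (Set ι)), (∀ x, lab x = c ↔ codeEquiv e x ∈ X) →
      mass p' (cell lab c) = ex (bernoulliWeight p) (ind X) := by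
    intro c X hX
    rw [ex_ind_eq_mass e p X]
    unfold cell
    congr 1
    exact Finset.filter_congr fun x _ => hX x
  rw [hc 4 (A ∩ B ∩ N) (labOf_eq_four_iff e), hc 0 (A ∪ B)ᶜ (labOf_eq_zero_iff e), hc 1 (A \ B) (labOf_eq_one_iff e),
    hc 2 (B \ A) (labOf_eq_two_iff e), hc 3 ((A ∩ B) \ N) (labOf_eq_three_iff e)] at key
  unfold SahiDeepCore.strongCubicMax SahiDeepCore.gladkovDefect
  linarith

end SahiSwitchFactored

end Summit.CriticalPhenomena.PercolationContinuityZ3.Theorems
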